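import Literature.NumberTheory.LFunctions.DworkRationalitySplitting
import Literature.NumberTheory.LFunctions.DworkRationalityMeromorphyProofs
import Mathlib.NumberTheory.Padics.RingHoms
import Mathlib.RingTheory.PowerSeries.Trunc
import Mathlib.RingTheory.PowerSeries.Expand
import Mathlib.FieldTheory.Finite.Basic
import HarnessLib

/-!
# The Dieudonné–Dwork lemma and integrality of the Artin–Hasse exponential

Part of the proof of `Literature.NumberTheory.LFunctions.Dwork.dworkLifting` (see
`…/DworkRationalitySplitting.lean` for the plan). This file proves, in `ℚ_p⟦X⟧`:

* `Dwork.norm_coeff_le_one_of_expand_eq` — the **Dieudonné–Dwork lemma** (the direction used by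
  Dwork): if `F ∈ 1 + Xℚ_p⟦X⟧` and `F(Xᵖ) = F(X)ᵖ · G(X)` with `G ∈ 1 + pXℤ_p⟦X⟧`, then
  `F ∈ ℤ_p⟦X⟧` (Lang, *Cyclotomic Fields I and II*, Ch. 14 §2, Lemma (Dieudonné–Dwork); Koblitz,
  GTM 58, Ch. IV §2, Lemma 3). We give the coefficient induction (Koblitz's proof): modulo `p`,
  `(∑_{i<n} aᵢXⁱ)ᵖ ≡ ∑_{i<n} aᵢX^{ip}` for `p`-integral `aᵢ` (Frobenius on `𝔽_p[X]`,
  `ZMod.expand_card`), and the coefficient of `Xⁿ` in `F(X)ᵖ` is that of the truncation plus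
  `p·aₙ`.
* `Dwork.expand_artinHasse` — `AH(Xᵖ) = AH(X)ᵖ · exp(-pX)` (Lang, loc. cit., proof of Thm. 2.1),
  from `ahLog(Xᵖ) = p·(ahLog(X) - X)`;
* `Dwork.norm_coeff_artinHasse_le_one` — **`AH(X) ∈ ℤ_p⟦X⟧`** (Lang, Ch. 14 §2, Thm. 2.1;
  Koblitz, Ch. IV §2), since `ord_p(pⁿ/n!) ≥ 1` for `n ≥ 1`.

## References

* S. Lang, *Cyclotomic Fields I and II*, GTM 121 (1990), Ch. 14 §2, Lemma (Dieudonné–Dwork) and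
  Thm. 2.1. [Lang1990]
* N. Koblitz, *p-adic Numbers, p-adic Analysis, and Zeta-Functions*, 2nd ed., GTM 58 (1984),
  Ch. IV §2. [Koblitz1984]
-/

open PowerSeries Finset

noncomputable section

namespace Literature.NumberTheory.LFunctions

namespace Dwork

/-! ### Coefficients of powers: truncation and the binomial step -/

section General

variable {R : Type*} [CommRing R]

/-- The coefficient of `Xⁿ` in `Fᵏ` only depends on the coefficients of `F` up to `Xⁿ`. [folklore] -/
theorem coeff_pow_eq_coeff_trunc_pow (F : R⟦X⟧) (n k : ℕ) :
    coeff n (F ^ k) = coeff n (((trunc (n + 1) F : Polynomial R) : R⟦X⟧) ^ k) := by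
  have h := congrArg (fun P : Polynomial R => P.coeff n) (trunc_trunc_pow F (n + 1) k)
  simp only [coeff_trunc, Nat.lt_succ_self, if_true] at h
  exact h.symm

/-- **Binomial step**: for `n ≥ 1` and `e ≥ 1`, the coefficient of `Xⁿ` in `(T + aXⁿ)ᵉ` is that of
`Tᵉ` plus `e · a · T(0)^{e-1}` (the terms with `(aXⁿ)ʲ`, `j ≥ 2`, have order `≥ 2n > n`). [folklore] -/
theorem coeff_add_C_mul_X_pow_pow (T : R⟦X⟧) (a : R) {n : ℕ} (hn : 0 < n) {e : ℕ} (he : 0 < e) :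
    coeff n ((T + C a * X ^ n) ^ e) = coeff n (T ^ e) + e * a * constantCoeff T ^ (e - 1) := by
  obtain ⟨e, rfl⟩ : ∃ e', e = e' + 1 := ⟨e - 1, (Nat.sub_add_cancel he).symm⟩
  rw [add_pow, map_sum, sum_range_succ, sum_range_succ, Nat.add_sub_cancel]
  -- terms `m < e`: `(aXⁿ)^{e+1-m}` has order `≥ 2n`
  have h0 : ∑ m ∈ range e, coeff n (T ^ m * (C a * X ^ n) ^ (e + 1 - m) *
      ((e + 1).choose m : R⟦X⟧)) = 0 := by
    refine sum_eq_zero fun m hm => ?_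
    rw [mem_range] at hm
    have h2n : 2 * n ≤ n * (e + 1 - m) := by
      have : 2 ≤ e + 1 - m := by omega
      calc 2 * n = n * 2 := by ring
        _ ≤ n * (e + 1 - m) := Nat.mul_le_mul_left n this
    rw [mul_pow, ← pow_mul, show T ^ m * (C a ^ (e + 1 - m) * X ^ (n * (e + 1 - m))) *
        ((e + 1).choose m : R⟦X⟧) = (T ^ m * C a ^ (e + 1 - m) * ((e + 1).choose m : R⟦X⟧)) *
          X ^ (n * (e + 1 - m)) by ring, coeff_mul_X_pow', if_neg (by omega)]
  rw [h0, zero_add]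
  -- `m = e`: `(e+1) · T^e · aXⁿ`
  have h1 : coeff n (T ^ e * (C a * X ^ n) ^ (e + 1 - e) * ((e + 1).choose e : R⟦X⟧)) =
      (e + 1 : ℕ) * a * constantCoeff T ^ e := by
    rw [show e + 1 - e = 1 by omega, pow_one, Nat.choose_succ_self_right,
      show T ^ e * (C a * X ^ n) * ((e + 1 : ℕ) : R⟦X⟧) = (T ^ e * C a * ((e + 1 : ℕ) : R⟦X⟧)) * X ^ n
        by ring, coeff_mul_X_pow', if_pos le_rfl, Nat.sub_self, ← map_natCast (C (R := R)) (e + 1),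
      coeff_zero_eq_constantCoeff_apply]
    simp only [map_mul, map_pow, constantCoeff_C, map_natCast]
    ring
  -- `m = e + 1`: `T^{e+1}`
  have h2 : coeff n (T ^ (e + 1) * (C a * X ^ n) ^ (e + 1 - (e + 1)) *
      ((e + 1).choose (e + 1) : R⟦X⟧)) = coeff n (T ^ (e + 1)) := by
    rw [Nat.sub_self, pow_zero, mul_one, Nat.choose_self, Nat.cast_one, mul_one]
  rw [h1, h2, add_comm]

end General

/-! ### Norm estimates in `ℚ_p⟦X⟧` -/

section Padic

variable {p : ℕ} [Fact p.Prime]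

/-- If the coefficients of `F` up to `Xᵐ` are `p`-integral, so are those of every power `Fᵏ`
(ultrametric inequality on the Cauchy product). [folklore] -/
theorem norm_coeff_pow_le_one {F : ℚ_[p]⟦X⟧} {m : ℕ} (h : ∀ i ≤ m, ‖coeff i F‖ ≤ 1) (k : ℕ) :
    ∀ i ≤ m, ‖coeff i (F ^ k)‖ ≤ 1 := by
  induction k with
  | zero =>
    intro i _
    rw [pow_zero, coeff_one]
    split_ifs <;> simp
  | succ k ih =>
    intro i hi
    rw [pow_succ, coeff_mul]
    refine IsUltrametricDist.norm_sum_le_of_forall_le_of_nonneg zero_le_one fun ij hij => ?_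
    rw [mem_antidiagonal] at hij
    rw [norm_mul]
    exact mul_le_one₀ (ih _ (by omega)) (norm_nonneg _) (h _ (by omega))

/-- An element of `ℤ_p` with norm `< 1` has norm `≤ p⁻¹` (it is divisible by `p`). [folklore] -/
theorem PadicInt.norm_le_inv_of_norm_lt_one {x : ℤ_[p]} (hx : ‖x‖ < 1) : ‖x‖ ≤ (p : ℝ)⁻¹ := by
  obtain ⟨y, rfl⟩ := (PadicInt.norm_lt_one_iff_dvd x).mp hx
  rw [norm_mul, PadicInt.norm_p]
  exact mul_le_of_le_one_right (inv_nonneg.mpr (Nat.cast_nonneg _)) (PadicInt.norm_le_one y)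

/-- **Frobenius congruence** for a polynomial `P ∈ ℤ_p[X]`: the coefficient of `Xⁿ` in `Pᵖ` is
congruent modulo `p` to the coefficient of `Xⁿ` in `P(Xᵖ)`, because `P̄(X)ᵖ = P̄(Xᵖ)` in `𝔽_p[X]`
(Mathlib `ZMod.expand_card`). [folklore] -/
theorem PadicInt.norm_coeff_pow_sub_coeff_expand_le (P : Polynomial ℤ_[p]) (n : ℕ) :
    ‖(P ^ p).coeff n - (if p ∣ n then P.coeff (n / p) else 0)‖ ≤ (p : ℝ)⁻¹ := by
  have h1 : (P ^ p).map (PadicInt.toZMod (p := p)) =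
      (Polynomial.expand ℤ_[p] p P).map (PadicInt.toZMod (p := p)) := by
    rw [Polynomial.map_pow, Polynomial.map_expand, ZMod.expand_card]
  have h2 : PadicInt.toZMod ((P ^ p).coeff n - (Polynomial.expand ℤ_[p] p P).coeff n) = 0 := by
    rw [map_sub, ← Polynomial.coeff_map, ← Polynomial.coeff_map, h1, sub_self]
  rw [Polynomial.coeff_expand (Fact.out : p.Prime).pos] at h2
  have h3 : (P ^ p).coeff n - (if p ∣ n then P.coeff (n / p) else 0) ∈
      RingHom.ker (PadicInt.toZMod (p := p)) := h2
  rw [PadicInt.ker_toZMod, IsLocalRing.mem_maximalIdeal, mem_nonunits_iff,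
    PadicInt.isUnit_iff] at h3
  exact PadicInt.norm_le_inv_of_norm_lt_one (lt_of_le_of_ne (PadicInt.norm_le_one _) h3)

/-- **The Dieudonné–Dwork lemma** (the implication used by Dwork; Lang, *Cyclotomic Fields I and
II*, Ch. 14 §2, Lemma; Koblitz, Ch. IV §2, Lemma 3): let `F ∈ 1 + Xℚ_p⟦X⟧` and suppose
`F(Xᵖ) = F(X)ᵖ · G(X)` with `G ∈ 1 + pXℤ_p⟦X⟧` (i.e. `G(0) = 1` and `‖gᵢ‖ ≤ p⁻¹` for `i ≥ 1`). Then
all coefficients of `F` are `p`-integral. Proof by induction on `n`: comparing coefficients of `Xⁿ`,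
`[p ∣ n] a_{n/p} = [Xⁿ]F(X)ᵖ + ∑_{j ≥ 1} gⱼ [X^{n-j}]Fᵖ`, where `[Xⁿ]Fᵖ = [Xⁿ](F_{<n})ᵖ + p aₙ` and
`(F_{<n})ᵖ ≡ F_{<n}(Xᵖ) (mod p)`; hence `‖p aₙ‖ ≤ p⁻¹`. [cite: Lang1990, Ch. 14 §2 Lemma (Dieudonné–Dwork)] [cite: Koblitz1984, Ch. IV §2] -/
theorem norm_coeff_le_one_of_expand_eq {F G : ℚ_[p]⟦X⟧} (hF : constantCoeff F = 1)
    (hG0 : constantCoeff G = 1) (hG : ∀ i, 0 < i → ‖coeff i G‖ ≤ (p : ℝ)⁻¹)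
    (hFG : expand p (Fact.out : p.Prime).ne_zero F = F ^ p * G) (n : ℕ) : ‖coeff n F‖ ≤ 1 := by
  have hp : p.Prime := Fact.out
  have hp1 : (1 : ℝ) < p := by exact_mod_cast hp.one_lt
  induction n using Nat.strong_induction_on with
  | _ n ih =>
  rcases Nat.eq_zero_or_pos n with rfl | hn
  · rw [coeff_zero_eq_constantCoeff_apply, hF, norm_one]
  -- the truncation `T = F_{<n}` and its integral lift `P ∈ ℤ_p[X]`
  set T : ℚ_[p]⟦X⟧ := ((trunc n F : Polynomial ℚ_[p]) : ℚ_[p]⟦X⟧) with hT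
  have hTc : ∀ i, coeff i T = if i < n then coeff i F else 0 := fun i => by
    rw [hT, Polynomial.coeff_coe, coeff_trunc]
  have hT0 : constantCoeff T = 1 := by
    rw [← coeff_zero_eq_constantCoeff_apply, hTc, if_pos hn, coeff_zero_eq_constantCoeff_apply, hF]
  let c : ℕ → ℤ_[p] := fun i => if h : i < n then ⟨coeff i F, ih i h⟩ else 0
  let P : Polynomial ℤ_[p] := ∑ i ∈ range n, Polynomial.monomial i (c i)
  have hPc : ∀ i, (P.coeff i : ℚ_[p]) = coeff i T := by
    intro i
    rw [hTc, Polynomial.finsetSum_coeff]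
    simp only [Polynomial.coeff_monomial, sum_ite_eq', mem_range]
    by_cases hi : i < n
    · rw [if_pos hi, if_pos hi]
      simp [c, hi]
    · rw [if_neg hi, if_neg hi, PadicInt.coe_zero]
  have hPmap : P.map (PadicInt.Coe.ringHom (p := p)) = trunc n F := by
    ext i
    rw [Polynomial.coeff_map, ← Polynomial.coeff_coe (trunc n F), ← hT, ← hPc]
    rfl
  -- (1) Frobenius: `[Xⁿ]Tᵖ ≡ [p ∣ n] a_{n/p} (mod p)`
  have hdiv : n / p < n := Nat.div_lt_self hn hp.one_lt
  have hA : coeff n (T ^ p) = ((P ^ p).coeff n : ℚ_[p]) := by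
    rw [hT, ← hPmap, ← Polynomial.coe_pow, Polynomial.coeff_coe, ← Polynomial.map_pow,
      Polynomial.coeff_map]
    rfl
  have hB : (if p ∣ n then coeff (n / p) F else 0) =
      ((if p ∣ n then P.coeff (n / p) else 0 : ℤ_[p]) : ℚ_[p]) := by
    split_ifs with hpn
    · rw [hPc, hTc, if_pos hdiv]
    · exact PadicInt.coe_zero.symm
  have h1 : ‖coeff n (T ^ p) - (if p ∣ n then coeff (n / p) F else 0)‖ ≤ (p : ℝ)⁻¹ := by
    have h := PadicInt.norm_coeff_pow_sub_coeff_expand_le P n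
    rw [PadicInt.norm_def, PadicInt.coe_sub] at h
    rw [hA, hB]
    exact h
  -- (2) binomial step: `[Xⁿ]Fᵖ = [Xⁿ]Tᵖ + p aₙ`
  have h2 : coeff n (F ^ p) = coeff n (T ^ p) + p * coeff n F := by
    rw [coeff_pow_eq_coeff_trunc_pow, trunc_succ, Polynomial.coe_add, Polynomial.coe_monomial,
      ← hT, monomial_eq_C_mul_X_pow, coeff_add_C_mul_X_pow_pow T _ hn hp.pos, hT0, one_pow, mul_one]
  -- (3) the coefficient identity from `F(Xᵖ) = Fᵖ G`
  have h3 : (if p ∣ n then coeff (n / p) F else 0) =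
      coeff n (F ^ p) + ∑ ij ∈ (antidiagonal n).erase (n, 0), coeff ij.1 (F ^ p) * coeff ij.2 G := by
    have h := congrArg (coeff n) hFG
    rw [coeff_expand, coeff_mul, ← add_sum_erase _ _ (show (n, 0) ∈ antidiagonal n by simp)] at h
    rw [h, coeff_zero_eq_constantCoeff_apply, hG0, mul_one]
  -- (4) the error terms are small
  have h4 : ‖∑ ij ∈ (antidiagonal n).erase (n, 0), coeff ij.1 (F ^ p) * coeff ij.2 G‖ ≤
      (p : ℝ)⁻¹ := by
    refine IsUltrametricDist.norm_sum_le_of_forall_le_of_nonneg (inv_nonneg.mpr (by positivity))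
      fun ij hij => ?_
    rw [mem_erase, mem_antidiagonal] at hij
    obtain ⟨hne, hsum⟩ := hij
    have hj : 0 < ij.2 := by
      rcases Nat.eq_zero_or_pos ij.2 with h0 | h0
      · exact absurd (Prod.ext (by omega) h0) hne
      · exact h0
    have hi : ij.1 < n := by omega
    rw [norm_mul]
    have ha : ‖coeff ij.1 (F ^ p)‖ ≤ 1 :=
      norm_coeff_pow_le_one (m := ij.1) (fun i hi' => ih i (by omega)) p ij.1 le_rfl
    calc ‖coeff ij.1 (F ^ p)‖ * ‖coeff ij.2 G‖ ≤ 1 * (p : ℝ)⁻¹ :=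
          mul_le_mul ha (hG _ hj) (norm_nonneg _) zero_le_one
      _ = (p : ℝ)⁻¹ := one_mul _
  -- (5) conclusion: `‖p aₙ‖ ≤ p⁻¹`
  have h5 : ‖(p : ℚ_[p]) * coeff n F‖ ≤ (p : ℝ)⁻¹ := by
    have heq : (p : ℚ_[p]) * coeff n F =
        -((coeff n (T ^ p) - (if p ∣ n then coeff (n / p) F else 0)) +
          ∑ ij ∈ (antidiagonal n).erase (n, 0), coeff ij.1 (F ^ p) * coeff ij.2 G) := by
      rw [h3, h2]; ring
    rw [heq, norm_neg]
    exact (IsUltrametricDist.norm_add_le_max _ _).trans (max_le h1 h4)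
  rw [norm_mul, Padic.norm_p] at h5
  have hp0 : (0 : ℝ) < (p : ℝ)⁻¹ := inv_pos.mpr (by positivity)
  exact le_of_mul_le_mul_left (by simpa using h5) hp0

/-! ### The Artin–Hasse exponential -/

/-- `HasSubst` for the Artin–Hasse logarithm (no constant term). [folklore] -/
theorem hasSubst_ahLog : HasSubst (ahLog p) := HasSubst.of_constantCoeff_zero' constantCoeff_ahLog

/-- **`ahLog(Xᵖ) = p·(ahLog(X) - X)`**: `∑ᵢ X^{p^{i+1}}/pⁱ = p(∑ᵢ X^{pⁱ}/pⁱ - X)` (Lang, Ch. 14 §2,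
proof of Thm. 2.1). [cite: Lang1990, Ch. 14 §2 Thm. 2.1] -/
theorem expand_ahLog : expand p (Fact.out : p.Prime).ne_zero (ahLog p) = p • (ahLog p - X) := by
  have hp : p.Prime := Fact.out
  have hp0 : (p : ℚ_[p]) ≠ 0 := by exact_mod_cast hp.ne_zero
  ext n
  rw [coeff_expand, map_nsmul, map_sub, coeff_ahLog n, coeff_X, nsmul_eq_mul]
  by_cases h1 : p ∣ n
  · rw [if_pos h1, coeff_ahLog]
    obtain ⟨m, rfl⟩ := h1
    rw [Nat.mul_div_cancel_left _ hp.pos]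
    have hne1 : p * m ≠ 1 := fun h => hp.ne_one (Nat.eq_one_of_mul_eq_one_right h)
    rw [if_neg hne1, sub_zero]
    by_cases h2 : ∃ i : ℕ, m = p ^ i
    · obtain ⟨i, rfl⟩ := h2
      rw [if_pos ⟨i, rfl⟩, if_pos ⟨i + 1, by ring⟩]
      push_cast
      field_simp
    · rw [if_neg h2, if_neg, mul_zero]
      rintro ⟨j, hj⟩
      cases j with
      | zero => rw [pow_zero] at hj; exact hne1 hj
      | succ j => exact h2 ⟨j, Nat.eq_of_mul_eq_mul_left hp.pos (by rw [hj, pow_succ'])⟩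
  · rw [if_neg h1]
    by_cases h6 : n = 1
    · subst h6
      rw [if_pos ⟨0, (pow_zero p).symm⟩, if_pos rfl, Nat.cast_one, inv_one, sub_self, mul_zero]
    · rw [if_neg h6, if_neg, sub_zero, mul_zero]
      rintro ⟨i, rfl⟩
      cases i with
      | zero => exact h6 (pow_zero p)
      | succ i => exact h1 (dvd_pow_self p (Nat.succ_ne_zero i))

/-- **`AH(Xᵖ) = AH(X)ᵖ · exp(-pX)`** (Lang, *Cyclotomic Fields I and II*, Ch. 14 §2, proof of
Thm. 2.1: `AH(X)ᵖ/AH(Xᵖ) = exp(p∑X^{pⁿ}/pⁿ)/exp(∑X^{p^{n+1}}/pⁿ) = exp(pX)`). [cite: Lang1990, Ch. 14 §2 Thm. 2.1] -/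
theorem expand_artinHasse : expand p (Fact.out : p.Prime).ne_zero (artinHasse p) =
    artinHasse p ^ p * (exp ℚ_[p]).subst (-(p • X : ℚ_[p]⟦X⟧)) := by
  have hp : p.Prime := Fact.out
  have hX : constantCoeff (-(p • X : ℚ_[p]⟦X⟧)) = 0 := by
    rw [map_neg, map_nsmul, constantCoeff_X, nsmul_zero, neg_zero]
  have hA : constantCoeff (p • ahLog p) = 0 := by
    rw [map_nsmul, constantCoeff_ahLog, nsmul_zero]
  rw [artinHasse, expand_apply, subst_comp_subst_apply hasSubst_ahLog (HasSubst.X_pow hp.ne_zero),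
    ← expand_apply p hp.ne_zero, expand_ahLog, smul_sub, sub_eq_add_neg,
    Literature.AlgebraicGeometry.Motives.FrobeniusTrace.exp_subst_add hA hX,
    exp_subst_nsmul constantCoeff_ahLog]

/-- The correction factor `exp(-pX) = ∑ (-p)ⁿ Xⁿ/n!` lies in `1 + pXℤ_p⟦X⟧`: `‖pⁿ/n!‖ ≤ p⁻¹` for
`n ≥ 1`, since `ord_p(n!) ≤ n - 1` (Legendre; Lang, Ch. 14 §2: "it suffices that
`ord pⁿ/n! ≥ 1` for all `n`, which is the case"). [cite: Lang1990, Ch. 14 §2 Thm. 2.1] -/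
theorem norm_coeff_exp_neg_pX_le {i : ℕ} (hi : 0 < i) :
    ‖coeff i ((exp ℚ_[p]).subst (-(p • X : ℚ_[p]⟦X⟧)))‖ ≤ (p : ℝ)⁻¹ := by
  have hp : p.Prime := Fact.out
  have hp1 : (1 : ℝ) < p := by exact_mod_cast hp.one_lt
  have hrw : (exp ℚ_[p]).subst (-(p • X : ℚ_[p]⟦X⟧)) = rescale (-(p : ℚ_[p])) (exp ℚ_[p]) := by
    rw [rescale_eq_subst, neg_smul, Nat.cast_smul_eq_nsmul]
  rw [hrw, coeff_rescale, coeff_exp, norm_mul, norm_pow, norm_neg, Padic.norm_p]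
  -- ‖1/i!‖ = p^{v_p(i!)} ≤ p^{i-1}
  have hfact : (i.factorial : ℚ_[p]) ≠ 0 := by exact_mod_cast i.factorial_ne_zero
  have hv : ‖(algebraMap ℚ ℚ_[p]) (1 / (i.factorial : ℚ))‖ = (p : ℝ) ^ (padicValNat p i.factorial : ℤ) := by
    rw [map_div₀, map_one, map_natCast, norm_div, norm_one,
      Padic.norm_eq_zpow_neg_valuation hfact, Padic.valuation_natCast, one_div, ← zpow_neg, neg_neg]
  have hleg : padicValNat p i.factorial ≤ i - 1 := by
    have h := sub_one_mul_padicValNat_factorial_lt_of_ne_zero p hi.ne'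
    have h1 : 1 ≤ p - 1 := Nat.le_sub_one_of_lt hp.one_lt
    have : padicValNat p i.factorial < i := lt_of_le_of_lt (Nat.le_mul_of_pos_left _ h1) h
    omega
  rw [hv]
  calc ((p : ℝ)⁻¹) ^ i * (p : ℝ) ^ (padicValNat p i.factorial : ℤ)
      ≤ ((p : ℝ)⁻¹) ^ i * (p : ℝ) ^ ((i - 1 : ℕ) : ℤ) := by
        refine mul_le_mul_of_nonneg_left ?_ (by positivity)
        exact zpow_le_zpow_right₀ hp1.le (by exact_mod_cast hleg)
    _ = (p : ℝ)⁻¹ := by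
        obtain ⟨j, rfl⟩ : ∃ j, i = j + 1 := ⟨i - 1, (Nat.sub_add_cancel hi).symm⟩
        rw [Nat.add_sub_cancel, zpow_natCast, pow_succ, inv_pow, mul_assoc, mul_comm ((p : ℝ)⁻¹),
          ← mul_assoc, inv_mul_cancel₀ (pow_ne_zero _ (by positivity)), one_mul]

/-- **The Artin–Hasse exponential has `p`-integral coefficients**: `AH(X) ∈ ℤ_p⟦X⟧`
(Lang, *Cyclotomic Fields I and II*, Ch. 14 §2, Thm. 2.1; Koblitz, Ch. IV §2), by the
Dieudonné–Dwork lemma applied to `AH(Xᵖ) = AH(X)ᵖ exp(-pX)`. [cite: Lang1990, Ch. 14 §2 Thm. 2.1] [cite: Koblitz1984, Ch. IV §2] -/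
theorem norm_coeff_artinHasse_le_one (n : ℕ) : ‖coeff n (artinHasse p)‖ ≤ 1 := by
  refine norm_coeff_le_one_of_expand_eq ?_ ?_ (fun i hi => norm_coeff_exp_neg_pX_le hi)
    expand_artinHasse n
  · exact Literature.AlgebraicGeometry.Motives.FrobeniusTrace.constantCoeff_exp_subst
      constantCoeff_ahLog
  · refine Literature.AlgebraicGeometry.Motives.FrobeniusTrace.constantCoeff_exp_subst ?_
    rw [map_neg, map_nsmul, constantCoeff_X, nsmul_zero, neg_zero]

/-- The constant term of the Artin–Hasse exponential is `1`. [cite: Koblitz1984, Ch. IV §2] -/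
theorem constantCoeff_artinHasse : constantCoeff (artinHasse p) = 1 :=
  Literature.AlgebraicGeometry.Motives.FrobeniusTrace.constantCoeff_exp_subst constantCoeff_ahLog

end Padic

end Dwork

end Literature.NumberTheory.LFunctions
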